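import Mathlib
import Summits.Ventures.FusionMHD.Models.RwmFRS1Kq08AlgebraicSuper
import Summits.Ventures.FusionMHD.Models.RwmFRS1Kq08AlgebraicSub
import Summits.Ventures.FusionMHD.Models.RwmFRS1Kq07Bessel
import Literature.MathematicalPhysics.MHD.NewcombRegularBranch
import HarnessLib

/-!
# F3 row «F3.σ-NEWCOMB-EXT-ALGEBRAIC-KQ08»: the `(m,n) = (2,1)` INTERNAL and EXTERNAL verdicts of MODEL M_RWM,8 from TWO POLYNOMIAL TEST
# FUNCTIONS — a Sturm supersolution and a subsolution of Newcomb's marginal equation — and `norm_num`, WITHOUT the axis-regular solution `ξ₁`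

LADDER-GRIDFUSION rung F3 (cell `gridfusion`; lead g10 RULING 9ds (4) on lit-4 g10's OFFER «F3.σ-NEWCOMB-EXT-ALGEBRAIC», INBOX 2026-08-28T00:45Z;
producer gridfusion-model-7 g7, 2026-08-28).  THE MECHANISM (lit-4's `Literature/MathematicalPhysics/MHD/NewcombRegularBranch.lean` §6–§7,
p588715/p590002, PROVED): for a regular axis (`B_θ = r u`), `m ≠ 0` and `F ≠ 0` on `(0, a]`, a positive `w` with `(fw′)′ = q ≤ gw` (a STURM
SUPERSOLUTION, Hartman XI §3 (3.2)) bounds the edge logarithmic derivative of the regular solution from BELOW (Picone), so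
`f(a)w′(a)/w(a) + (FF†/k₀² + a²F²Λ/m)(a) > 0` makes EVERY admissible displacement have positive external energy (11.98)
(`Profile.newcombExternalStable_of_supersolution`); a `w` with `gw² ≤ qw`, `w(a) ≠ 0` (a SUBSOLUTION) and that quantity `< 0` IS an explicit
external kink (`Profile.newcombExternalUnstable_of_subsolution`); `g ≥ 0` gives internal stability in one line (`Profile.newcombStable_of_newcombG_nonneg`).

THIS CHAIN (parts 1/3 `…AlgebraicSuper`, 2/3 `…AlgebraicSub`, and this file 3/3 = the sentences) applies it to MODEL M_RWM,8 = the EXACT force-balanced `q₀ = 4/5` screw pinch `Kq08.P8` of `Models/RwmFRS1Kq08Profile.lean` (`B_z ≡ 1`,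
`B_θ = r/(4(1+r²))`, force-balance pressure, `μ₀ = 1`, `a = 1`, `R₀ = 5a` so `k = −1/5`; `Kq08.isRadialPressureBalance`), helicity `(m, n) = (2, 1)`
(`q_a = 8/5 < 2`, `F ≠ 0` in the plasma), with Newcomb's `f`, `g`, `f′` in the CLOSED FORMS of `Models/RwmFRS1Kq08.lean` (model-6 g8: `newcombF_eq`,
`newcombG_eq`, `hasDerivAt_newcombF`, `newcombG_pos`, `edge_values`) and the `m = 2` wall factors of `Models/RwmFRS1Kq07Bessel.lean` BY NAME.
The two test functions are odd polynomials `w = κ + r·W(r²)` (`κ = 10⁻⁴`, `W` quintic) and `v = r·V(r²)` (`V` sextic) found by a linear programme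
(generator `pub/gridfusion/models/model-7/g7/newc/`); `(fw′)′ ≤ gw` and `gv ≤ (fv′)′` on `(0, 1)` reduce, after clearing the positive denominators
`100(1+r²)³(r²+100)²`, to the nonnegativity on `[0, 1]` of ONE polynomial each (`Nsup`, degree 9; `Msub`, degree 10), certified by its Bernstein
coefficients on `[0, ½]` and `[½, 1]` (Cargo–Shisha / Garloff–Smith range enclosure: an identity checked by `ring`, signs by `norm_num`)
[cite: GarloffSmith2001, §2.1 Lemma 1 (i) eq. (3)].  Their edge logarithmic derivatives `L_w = w′(1)/w(1) = 3.75909…` and `L_v = v′(1)/v(1) = 4.15020…`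
bracket the row-of-record value `L_8 = 3.9795679…` of `ξ₁` (`Models/RwmFRS1Kq08Solution.lean`, NOT imported here) from both sides, as Sturm comparison dictates.

CERTIFIED SENTENCES (MODEL M_RWM,8, helicity `(2,1)`; admissible = `C¹(−51/50·a, 51/50·a)`, `≢ 0` on `[0, a]`, the class of the rows of record):
1. **`internal_stable_of_gt`** — for EVERY `b > a`, every INTERNAL displacement `ξ ∈ C¹(−b, b)`, `ξ(a) = 0`, `ξ ≢ 0` has `0 < fluidEnergy 2 k 1 ξ`
   (`g > 0` on `(0, a]`: `w ≡ 1`; the `b = 51/50·a` instance is the row-of-record `Kq08.internal_stable_21`, via `ξ₁`).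
2. **`external_stable_of_le`** — for EVERY wall factor `Λ ≥ 13/5` every admissible displacement has `0 < externalEnergy 2 k 1 Λ ξ` (supersolution `w`);
   hence **`idealWall_stable_12`** (ideal wall at `b = 6/5·a`: `Λ_b ≥ 2.771`, `Kq07.lambdaWall_24_bounds`) and **`idealWall_window`** (every `a < b ≤ 6/5·a`,
   `Λ_b` decreasing in `b`: lit-3 `Vacuum.strictAntiOn_wallFactor`).
3. **`external_unstable_of_le`** — for EVERY `Λ ≤ 12/5` the explicit displacement `v` has `externalEnergy 2 k 1 Λ v < 0` (subsolution); hence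
   **`noWall_unstable`** (`Λ_∞ < 1`, lit-3 `Vacuum.wallFactorInf_lt_one`), **`wall_13_unstable`** (`b = 13/10·a`: `Λ_b ≤ 2.099`, `Kq07.lambdaWall_26_bounds`),
   **`farWall_unstable`** (every `b ≥ 13/10·a`), and **`noWall_not_stable`**.
So the critical wall factor of this helicity lies in `(12/5, 13/5)` and the critical wall radius in `(6/5·a, 13/10·a)` — the SAME window as the row of
record «F3.r4-KINKEQ08-RWM21» (`RwmFRS1Kq08Energy`: `Λ_crit ∈ (2.485362, 2.485363)`, `6/5·a < b* < 13/10·a`), obtained here with no Frobenius series,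
no Taylor chain, no interval ODE enclosure: two polynomials, `ring`, `norm_num`.  JUXTAPOSED with that row, never merged; the thin-wall growth RATE
(which needs the two-sided `L_8` bracket) stays with the row of record.
THREE COLUMNS.  CERTIFIED: the theorems below (kernel, this file + imports, axioms standard, no `native_decide`).  VALIDATED (not load-bearing): floats
`L_w = 3.75910`, `L_v = 4.15020`, `Λ_crit(L_w) = 2.5945`, `Λ_crit(L_v) = 2.4009` vs `Λ_crit(L_8) = 2.48536` (generator `newc/gen.py`).  MODELLED: straight
circular-cylinder screw pinch, ideal MHD, single helicity `(2,1)`, vacuum region with the wall factor `Λ` of Freidberg (11.96) (ideal wall) / `Λ_∞` (no wall);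
`q₀ = 4/5`, `R₀ = 5a` and the wall radii DECLARED SYNTHETIC; absent: toroidicity, resistivity, rotation; the `(1,1)` internal kink of this member (resonant
at `q = 1`) is NOT treated; «stable»/«unstable» are statements about the sign of the reduced energy of MODEL M_RWM,8 — nothing about a device. [instance data]
Citations: Freidberg 2014 §11.5.1 (11.90), (11.96)–(11.98), §11.5.3 (11.110)–(11.118), §11.5.6 (11.148)–(11.151) [Freidberg2014]; Hartman 1964/2002 Ch. XI §3
(3.2), Thm 3.1 [Hartman2002]; Garloff–Smith 2001 §2.1 Lemma 1 [GarloffSmith2001].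
-/

noncomputable section

open Set Literature.MathematicalPhysics.MHD Literature.MathematicalPhysics.MHD.ScrewPinch

namespace Summit.Ventures.FusionMHD.Models

namespace RwmFRS1

namespace Kq08

namespace Alg

/-! ### The model's hypotheses in the form of lit-4's §6–§7 (regular axis `B_θ = r·u8`) -/

/-- `u(r) = 1/(4(1+r²))` is `C¹` on `ℝ`. [instance data] -/
theorem u8_contDiff : ContDiff ℝ 1 u8 := by
  have e : u8 = fun r : ℝ => 1 / (4 * (1 + r ^ 2)) := funext fun r => rfl
  rw [e]
  exact contDiff_const.div (by fun_prop) fun r => by positivity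

/-- `F ≠ 0` at the axis in the regularised form: `kB_z(0) + m·u(0) = −1/5 + 2·(1/4) = 3/10 ≠ 0`. [instance data] -/
theorem axis_ne : kk * P8.Bz 0 + 2 * u8 0 ≠ 0 := by
  rw [P8_Bz, kk]
  unfold u8
  norm_num

/-- `F ≠ 0` on `(0, a]` (`q < 2` in the plasma). [instance data] -/
theorem kDotB_ne : ∀ r ∈ Ioc (0 : ℝ) 1, P8.kDotB 2 kk r ≠ 0 :=
  fun r hr => kDotB_ne_zero hr.1 (by nlinarith [hr.1, hr.2])

/-! ### Sentence 1: internal `(2,1)` displacements — `g > 0`, the supersolution `w ≡ 1`, every regularity domain -/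

/-- **INTERNAL `(2,1)` DISPLACEMENTS OF MODEL M_RWM,8 HAVE POSITIVE ENERGY, FOR EVERY REGULARITY DOMAIN `(−b, b)`, `b > 1`**: every
`ξ ∈ C¹(−b, b)` with `ξ(1) = 0`, `ξ ≢ 0` on `[0, 1]` has `0 < fluidEnergy 2 k 1 ξ` — Newcomb's `g > 0` on `(0, a]` (`Kq08.newcombG_pos`) and
lit-4's one-line certificate `Profile.newcombStable_of_newcombG_nonneg` (the supersolution `w ≡ 1`; no regular solution, no first-zero search).
The instance `b = 51/50` is the row-of-record sentence `Kq08.internal_stable_21` (`Models/RwmFRS1InternalModes.lean`, via `ξ₁`; not imported).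
[cite: Freidberg2014, §11.5.3 eqs. (11.110)–(11.114)] [cite: Hartman2002, Ch. XI §3 (3.2)] -/
theorem internal_stable_of_gt {b : ℝ} (hb : 1 < b) : ∀ ξ : ℝ → ℝ, ContDiffOn ℝ 1 ξ (Ioo (-b) b) → ξ 1 = 0 →
    (∃ r ∈ Icc (0 : ℝ) 1, ξ r ≠ 0) → 0 < P8.fluidEnergy 2 kk 1 ξ := by
  obtain ⟨-, hBz, hp, -⟩ := profile_regular b
  exact Profile.newcombStable_of_newcombG_nonneg (P := P8) (m := 2) (k := kk) (u := u8) (a := 1) (b := b) one_pos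
    hb two_ne_zero hBz hp u8_contDiff.contDiffOn (fun r _ => rfl) kDotB_ne axis_ne
    (fun r hr => (newcombG_pos hr.1 hr.2.le).le)

/-! ### Sentence 2: EXTERNAL STABILITY for every wall factor `Λ ≥ 13/5` (the supersolution `w`) -/

/-- **EVERY ADMISSIBLE `(2,1)` DISPLACEMENT OF MODEL M_RWM,8 HAS POSITIVE EXTERNAL ENERGY WHEN `Λ ≥ 13/5`**:
`f(1)w′(1)/w(1) − 9/1616 + Λ/800 > 0` for the supersolution `w` (`L_w = 3.759…`, i.e. `Λ > 50(9 − L_w)/101 = 2.5945…` suffices; stated at `13/5`)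
and lit-4's `Profile.newcombExternalStable_of_supersolution` — no `ξ₁`. [cite: Freidberg2014, §11.5.3 eqs. (11.117)–(11.118)]
[cite: Hartman2002, Ch. XI §3 (3.2) with Theorem 3.1] -/
theorem external_stable_of_le {Λ : ℝ} (hΛ : 13 / 5 ≤ Λ) : ∀ ξ : ℝ → ℝ, ContDiffOn ℝ 1 ξ (Ioo (-(51 / 50)) (51 / 50)) →
    (∃ r ∈ Icc (0 : ℝ) 1, ξ r ≠ 0) → 0 < P8.externalEnergy 2 kk 1 Λ ξ := by
  obtain ⟨-, hBz, hp, -⟩ := profile_regular (51 / 50)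
  obtain ⟨Q, hQ⟩ := isCompact_Icc.exists_bound_of_continuousOn (qsup_continuous.continuousOn (s := Icc (0 : ℝ) 1))
  have hqQ : ∀ r ∈ Ioc (0 : ℝ) 1, |qsup r| ≤ Q := fun r hr => by
    simpa only [Real.norm_eq_abs] using hQ r ⟨hr.1.le, hr.2⟩
  have hw : ContDiffOn ℝ 1 wsup (Ioo 0 (51 / 50)) := by
    have : ContDiff ℝ 1 wsup := by unfold wsup Wsup; fun_prop
    exact this.contDiffOn
  obtain ⟨hF1, hFd1, hk1, hf1⟩ := edge_values
  obtain ⟨hw1, hdw1⟩ := wsup_edge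
  have hW : 0 < P8.newcombF 2 kk 1 * deriv wsup 1 / wsup 1
      + (P8.kDotB 2 kk 1 * P8.kDotBDagger 2 kk 1 / Profile.k0Sq 2 kk 1 + 1 ^ 2 * P8.kDotB 2 kk 1 ^ 2 * Λ / 2) := by
    rw [hf1, hF1, hFd1, hk1, hw1, hdw1]
    norm_num
    linarith
  exact Profile.newcombExternalStable_of_supersolution (P := P8) (m := 2) (k := kk) (u := u8) (a := 1) (b := 51 / 50)
    (w := wsup) (q := qsup) one_pos (by norm_num) two_ne_zero hBz hp u8_contDiff.contDiffOn (fun r _ => rfl) kDotB_ne axis_ne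
    hw (by norm_num) (fun r hr => wsup_ge hr) (qsup_continuous.continuousOn.mono Ioc_subset_Icc_self) hqQ
    (fun r hr => wsup_ode hr.1) (fun r hr => wsup_super hr) Λ hW

/-- **IDEAL WALL AT `b = 6/5·a`: every admissible displacement has positive energy** (`Λ_b ≥ 2.771 ≥ 13/5`, row #109's bracket
`Kq07.lambdaWall_24_bounds` by name). [cite: Freidberg2014, §11.5.1 eq. (11.96)] -/
theorem idealWall_stable_12 : ∀ ξ : ℝ → ℝ, ContDiffOn ℝ 1 ξ (Ioo (-(51 / 50)) (51 / 50)) →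
    (∃ r ∈ Icc (0 : ℝ) 1, ξ r ≠ 0) → 0 < P8.externalEnergy 2 kk 1 (Vacuum.wallFactor 2 kk 1 (6 / 5)) ξ := by
  have hΛ : (2771 / 1000 : ℝ) ≤ Vacuum.wallFactor 2 kk 1 (6 / 5) := by
    rw [Kq07.wallFactor_two_eq, show (1 / 5 : ℝ) * (6 / 5) = 6 / 25 by norm_num]
    exact Kq07.lambdaWall_24_bounds.1
  exact external_stable_of_le (by linarith)

/-- **THE IDEAL-WALL WINDOW**: for every wall radius `a < b ≤ 6/5·a` every admissible displacement has positive energy (`Λ_b` decreasing in `b`,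
lit-3 `Vacuum.strictAntiOn_wallFactor`). [cite: Freidberg2014, §11.5.6 eqs. (11.150)–(11.151)] -/
theorem idealWall_window {b : ℝ} (hb1 : 1 < b) (hb2 : b ≤ 6 / 5) : ∀ ξ : ℝ → ℝ, ContDiffOn ℝ 1 ξ (Ioo (-(51 / 50)) (51 / 50)) →
    (∃ r ∈ Icc (0 : ℝ) 1, ξ r ≠ 0) → 0 < P8.externalEnergy 2 kk 1 (Vacuum.wallFactor 2 kk 1 b) ξ := by
  have hk : kk ≠ 0 := by rw [kk]; norm_num
  have hmono := Vacuum.strictAntiOn_wallFactor (m := 2) (by norm_num) hk one_pos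
  have hΛ0 : (2771 / 1000 : ℝ) ≤ Vacuum.wallFactor 2 kk 1 (6 / 5) := by
    rw [Kq07.wallFactor_two_eq, show (1 / 5 : ℝ) * (6 / 5) = 6 / 25 by norm_num]
    exact Kq07.lambdaWall_24_bounds.1
  have hΛ : Vacuum.wallFactor 2 kk 1 (6 / 5) ≤ Vacuum.wallFactor 2 kk 1 b := by
    rcases eq_or_lt_of_le hb2 with h | h
    · rw [h]
    · exact (hmono (show (1 : ℝ) < b from hb1) (show (1 : ℝ) < 6 / 5 by norm_num) h).le
  exact external_stable_of_le (by linarith)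

/-! ### Sentence 3: EXTERNAL INSTABILITY for every wall factor `Λ ≤ 12/5` (the subsolution `v` is the kink) -/

/-- **FOR `Λ ≤ 12/5` THE EXPLICIT DISPLACEMENT `v` HAS NEGATIVE EXTERNAL ENERGY** in MODEL M_RWM,8, helicity `(2,1)`:
`f(1)v′(1)/v(1) − 9/1616 + Λ/800 < 0` (`L_v = 4.150…`, i.e. `Λ < 50(9 − L_v)/101 = 2.4009…`; stated at `12/5`) and lit-4's
`Profile.newcombExternalUnstable_of_subsolution`. [cite: Freidberg2014, §11.5.3 eqs. (11.117)–(11.118)] [cite: Hartman2002, Ch. XI §3 (3.2) with Theorem 3.1] -/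
theorem external_unstable_of_le {Λ : ℝ} (hΛ : Λ ≤ 12 / 5) : ∃ ξ : ℝ → ℝ, ContDiffOn ℝ 1 ξ (Ioo (-(51 / 50)) (51 / 50)) ∧
    (∃ r ∈ Icc (0 : ℝ) 1, ξ r ≠ 0) ∧ P8.externalEnergy 2 kk 1 Λ ξ < 0 := by
  obtain ⟨-, hBz, hp, -⟩ := profile_regular (51 / 50)
  have hv : ContDiffOn ℝ 1 vsub (Ioo (-(51 / 50)) (51 / 50)) := by
    have : ContDiff ℝ 1 vsub := by unfold vsub Vsub; fun_prop
    exact this.contDiffOn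
  obtain ⟨hF1, hFd1, hk1, hf1⟩ := edge_values
  obtain ⟨hv1, hdv1⟩ := vsub_edge
  have hva : vsub 1 ≠ 0 := by rw [hv1]; norm_num
  have hW : P8.newcombF 2 kk 1 * deriv vsub 1 / vsub 1
      + (P8.kDotB 2 kk 1 * P8.kDotBDagger 2 kk 1 / Profile.k0Sq 2 kk 1 + 1 ^ 2 * P8.kDotB 2 kk 1 ^ 2 * Λ / 2) < 0 := by
    rw [hf1, hF1, hFd1, hk1, hv1, hdv1]
    norm_num
    linarith
  exact Profile.newcombExternalUnstable_of_subsolution (P := P8) (m := 2) (k := kk) (u := u8) (a := 1) (b := 51 / 50)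
    (w := vsub) (q := qsub) one_pos (by norm_num) two_ne_zero hBz hp u8_contDiff.contDiffOn (fun r _ => rfl) kDotB_ne axis_ne
    hv qsub_continuous.continuousOn (fun r hr => vsub_ode hr.1) (fun r hr => vsub_sub hr) Λ hva hW

/-- **NO WALL: the `(2,1)` external kink of MODEL M_RWM,8** — `Λ_∞ < 1 ≤ 12/5` (lit-3's generic `Vacuum.wallFactorInf_lt_one`), so the explicit
displacement `v` has `δW < 0`. [cite: Freidberg2014, §11.5.6 eqs. (11.149)–(11.151)] -/
theorem noWall_unstable : ∃ ξ : ℝ → ℝ, ContDiffOn ℝ 1 ξ (Ioo (-(51 / 50)) (51 / 50)) ∧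
    (∃ r ∈ Icc (0 : ℝ) 1, ξ r ≠ 0) ∧ P8.externalEnergy 2 kk 1 (Vacuum.wallFactorInf 2 kk 1) ξ < 0 := by
  have hΛ : Vacuum.wallFactorInf 2 kk 1 < 1 :=
    Vacuum.wallFactorInf_lt_one (by norm_num) (by rw [kk]; norm_num) one_pos
  exact external_unstable_of_le (by linarith)

/-- **NO WALL, class form**: NOT every admissible displacement has positive no-wall energy (MODEL M_RWM,8, helicity `(2,1)`).
[cite: Freidberg2014, §11.5.6 eq. (11.151)] -/
theorem noWall_not_stable : ¬ (∀ ξ : ℝ → ℝ, ContDiffOn ℝ 1 ξ (Ioo (-(51 / 50)) (51 / 50)) →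
    (∃ r ∈ Icc (0 : ℝ) 1, ξ r ≠ 0) → 0 < P8.externalEnergy 2 kk 1 (Vacuum.wallFactorInf 2 kk 1) ξ) := by
  intro hall
  obtain ⟨ξ, hξ, hne, hneg⟩ := noWall_unstable
  have := hall ξ hξ hne
  linarith

/-- **IDEAL WALL AT `b = 13/10·a` DOES NOT STABILISE**: `Λ_b ≤ 2.099 ≤ 12/5` (`Kq07.lambdaWall_26_bounds` by name), so `v` has negative energy.
[cite: Freidberg2014, §11.5.1 eq. (11.96)] -/
theorem wall_13_unstable : ∃ ξ : ℝ → ℝ, ContDiffOn ℝ 1 ξ (Ioo (-(51 / 50)) (51 / 50)) ∧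
    (∃ r ∈ Icc (0 : ℝ) 1, ξ r ≠ 0) ∧ P8.externalEnergy 2 kk 1 (Vacuum.wallFactor 2 kk 1 (13 / 10)) ξ < 0 := by
  have hΛ : Vacuum.wallFactor 2 kk 1 (13 / 10) ≤ (2099 / 1000 : ℝ) := by
    rw [Kq07.wallFactor_two_eq, show (1 / 5 : ℝ) * (13 / 10) = 13 / 50 by norm_num]
    exact Kq07.lambdaWall_26_bounds.2
  exact external_unstable_of_le (by linarith)

/-- **FAR WALLS DO NOT STABILISE**: for every `b ≥ 13/10·a` the displacement `v` has negative ideal-wall energy (`Λ_b` decreasing in `b`).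
[cite: Freidberg2014, §11.5.6 eq. (11.150)] -/
theorem farWall_unstable {b : ℝ} (hb : 13 / 10 ≤ b) : ∃ ξ : ℝ → ℝ, ContDiffOn ℝ 1 ξ (Ioo (-(51 / 50)) (51 / 50)) ∧
    (∃ r ∈ Icc (0 : ℝ) 1, ξ r ≠ 0) ∧ P8.externalEnergy 2 kk 1 (Vacuum.wallFactor 2 kk 1 b) ξ < 0 := by
  have hk : kk ≠ 0 := by rw [kk]; norm_num
  have hmono := Vacuum.strictAntiOn_wallFactor (m := 2) (by norm_num) hk one_pos
  have hΛ0 : Vacuum.wallFactor 2 kk 1 (13 / 10) ≤ (2099 / 1000 : ℝ) := by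
    rw [Kq07.wallFactor_two_eq, show (1 / 5 : ℝ) * (13 / 10) = 13 / 50 by norm_num]
    exact Kq07.lambdaWall_26_bounds.2
  have hΛ : Vacuum.wallFactor 2 kk 1 b ≤ Vacuum.wallFactor 2 kk 1 (13 / 10) := by
    rcases eq_or_lt_of_le hb with h | h
    · rw [h]
    · exact (hmono (show (1 : ℝ) < 13 / 10 by norm_num) (show (1 : ℝ) < b by linarith) h).le
  exact external_unstable_of_le (by linarith)

/-- **THE ALGEBRAIC WINDOW, summary**: stable side for every `Λ ≥ 13/5`, unstable side for every `Λ ≤ 12/5` — the critical wall factor of the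
`(2,1)` helicity of MODEL M_RWM,8 lies in `(12/5, 13/5)` (row of record: `2.485362 < Λ_crit < 2.485363`), from two polynomials. [instance data] -/
theorem window :
    (∀ Λ : ℝ, 13 / 5 ≤ Λ → ∀ ξ : ℝ → ℝ, ContDiffOn ℝ 1 ξ (Ioo (-(51 / 50)) (51 / 50)) → (∃ r ∈ Icc (0 : ℝ) 1, ξ r ≠ 0) →
      0 < P8.externalEnergy 2 kk 1 Λ ξ) ∧
    (∀ Λ : ℝ, Λ ≤ 12 / 5 → ∃ ξ : ℝ → ℝ, ContDiffOn ℝ 1 ξ (Ioo (-(51 / 50)) (51 / 50)) ∧ (∃ r ∈ Icc (0 : ℝ) 1, ξ r ≠ 0) ∧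
      P8.externalEnergy 2 kk 1 Λ ξ < 0) :=
  ⟨fun _ hΛ => external_stable_of_le hΛ, fun _ hΛ => external_unstable_of_le hΛ⟩

end Alg

end Kq08

end RwmFRS1

end Summit.Ventures.FusionMHD.Models

end
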